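import Summits.QuantumFields.BalabanUV.T4Continuum.Support.DirichletCutoutFarPart

/-!
# `BalabanUV.T4Continuum.Support.DirichletCutoutBudgetConstants` — NE2 (node U1a) formalisation swarm, sub-row `T4-U1a.S-NE2-D1-DIRICHLET°`, supplier item
# «Δ1-SKELETON» (file 20): SCALING OF THE FAR-PART CONSTANTS — with `Y = n/(R − 1)` (`2 ≤ R`, `R − 1 ≤ n`) the smoothness constants of the
# product cutoff and of the corner cut-out read `n·ell1 = c₁Y`, `n·ell1C = c₁d²Y`, `n²·ell2 = c₂Y²`, `n²·ell2C = c₂′Y²`, whence the two factors of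
# file 11's far-part END obey `A₁ ≤ a₁·Y`, `A₂ ≤ a₂·Y²` and `A₁A₂ ≤ Kfar·Y³` with constants depending on `d, a′` only
# (unit b2b-balaban-t4-ne2-formalise-leaf-08, gen 7, file 20)

HONEST FRAMING.  Elementary real arithmetic at MODEL level; [folklore]; NE2 (U1a) is NOT proved by this file; spine PROVED 0/9 unchanged;
NOT infinite volume, NOT the mass gap, NOT Clay.  HONEST DEPENDENCY (verbatim): «continuum YM on T⁴ ⇐ BetaPertH ∧ nine spine estimates (0/9
proved); BetaPertH ⇐ (D1) ∧ (D4) ∧ CAP+tail; G-an2-4 gates asym, D1 and NE2/3/4.»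

WHAT THIS FILE PROVES (0 sorry).  Data `c1`, `c2`, `c2C`, `aE`, `a1`, `aD`, `a2`, `Kfar`; identities `mul_ell1`, `mul_ell1C`, `sq_mul_ell2`,
`sq_mul_ell2C`; bounds `AE_le`, `A1_le`, `AD_le`, `A2_le`, END **`A1_mul_A2_le`** (`A₁A₂ ≤ Kfar·Y³`), and `ell1C_sq_window_le`
(`ell1C²·(8R+11)(8R+12) ≤ (28c₁d²)²`, the near-part window constant for `m = 2R + 3`).

ABSOLUTE RULE (cell, verbatim): «No internally-minted statement may enter as a cited fact. Every hypothesis is either kernel-proved in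
this package or a verbatim quotation of a PUBLISHED theorem with page reference. The manuscript(s) under audit are NOT citable for
their own disputed steps — they are the thing under adjudication; programme-internal (2001/route/tribunal) claims are never citable.»
[folklore]; data definitions (constants); no `def … : Prop` fact.  NOT CLAIMED: any rate, NE2, NE3.
-/

noncomputable section

open scoped BigOperators

namespace Summit.QuantumFields.BalabanUV.T4Continuum.DirichletCutoutBudgetConstants

open Summit.QuantumFields.BalabanUV.T4Continuum.ScalarAveragedPropagator (gammaPs gammaPs_pos)
open Summit.QuantumFields.BalabanUV.T4Continuum.ScaleProfile (lip1 lip2 lip1_nonneg lip2_nonneg)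
open Summit.QuantumFields.BalabanUV.T4Continuum.DirichletMonotoneCutoff (pred_pos)
open Summit.QuantumFields.BalabanUV.T4Continuum.DirichletDipCutoffSmooth (ell1 ell2)
open Summit.QuantumFields.BalabanUV.T4Continuum.DirichletCornerCutoutEta (ell1C ell2C)
open Summit.QuantumFields.BalabanUV.T4Continuum.DirichletCutoutFarPart (AE AD A1 A2)

/-- `c₁ = 9·3^d`. [folklore] -/
def c1 (d : ℕ) : ℝ := 9 * 3 ^ d

/-- `c₂ = 36·3^d + 2c₁²`. [folklore] -/
def c2 (d : ℕ) : ℝ := 36 * 3 ^ d + 2 * c1 d ^ 2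

/-- `c₂′ = 36·3^d·d² + 2c₁²d⁴`. [folklore] -/
def c2C (d : ℕ) : ℝ := 36 * 3 ^ d * d ^ 2 + 2 * c1 d ^ 2 * d ^ 4

/-- `a_E = √(2γ′⁻¹ + 2d⁵c₁²γ′⁻²)`. [folklore] -/
def aE (d : ℕ) (a' : ℝ) : ℝ := Real.sqrt (2 * (gammaPs d a')⁻¹ + 2 * d ^ 5 * c1 d ^ 2 * (gammaPs d a')⁻¹ ^ 2)

/-- `a₁ = √(2a_E² + 2dc₁²γ′⁻²)`. [folklore] -/
def a1 (d : ℕ) (a' : ℝ) : ℝ := Real.sqrt (2 * aE d a' ^ 2 + 2 * d * c1 d ^ 2 * (gammaPs d a')⁻¹ ^ 2)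

/-- `a_Δ = √(2(1+(a′γ′⁻¹)²)) + d(2c₁d²√γ′⁻¹ + c₂′γ′⁻¹)`. [folklore] -/
def aD (d : ℕ) (a' : ℝ) : ℝ :=
  Real.sqrt (2 * (1 + (a' * (gammaPs d a')⁻¹) ^ 2)) + d * (2 * (c1 d * d ^ 2) * Real.sqrt ((gammaPs d a')⁻¹) + c2C d * (gammaPs d a')⁻¹)

/-- `a₂ = a_Δ + d(2c₁a_E + c₂γ′⁻¹)`. [folklore] -/
def a2 (d : ℕ) (a' : ℝ) : ℝ := aD d a' + d * (2 * c1 d * aE d a' + c2 d * (gammaPs d a')⁻¹)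

/-- the far-part constant `Kfar = a₁a₂`. [folklore] -/
def Kfar (d : ℕ) (a' : ℝ) : ℝ := a1 d a' * a2 d a'

variable {d : ℕ} {a' : ℝ} {n R : ℕ}

/-- `c₁ ≥ 0`. [folklore] -/
theorem c1_nonneg (d : ℕ) : 0 ≤ c1 d := by unfold c1; positivity

/-- `a_E ≥ 0`. [folklore] -/
theorem aE_nonneg (d : ℕ) (a' : ℝ) : 0 ≤ aE d a' := Real.sqrt_nonneg _

/-- `a₁ ≥ 0`. [folklore] -/
theorem a1_nonneg (d : ℕ) (a' : ℝ) : 0 ≤ a1 d a' := Real.sqrt_nonneg _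

/-- `a_Δ ≥ 0`. [folklore] -/
theorem aD_nonneg (d : ℕ) (a' : ℝ) : 0 ≤ aD d a' := by
  have := (gammaPs_pos (d := d) (a' := a')).1
  have := c1_nonneg d
  unfold aD c2C; positivity

/-- `a₂ ≥ 0`. [folklore] -/
theorem a2_nonneg (d : ℕ) (a' : ℝ) : 0 ≤ a2 d a' := by
  have := (gammaPs_pos (d := d) (a' := a')).1
  have := c1_nonneg d
  have := aD_nonneg d a'
  have := aE_nonneg d a'
  unfold a2 c2; positivity

/-- `Kfar ≥ 0`. [folklore] -/
theorem Kfar_nonneg (d : ℕ) (a' : ℝ) : 0 ≤ Kfar d a' := mul_nonneg (a1_nonneg d a') (a2_nonneg d a')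

section Scaling

variable (hR : 2 ≤ R)
include hR

/-- `n·ell1 = c₁·Y`. [folklore] -/
theorem mul_ell1 (d n : ℕ) : (n : ℝ) * ell1 d R = c1 d * ((n : ℝ) / ((R : ℝ) - 1)) := by
  have h := (pred_pos hR).ne'
  unfold ell1 lip1 c1
  field_simp
  ring

/-- `n·ell1C = c₁d²·Y`. [folklore] -/
theorem mul_ell1C (d n : ℕ) : (n : ℝ) * ell1C d R = c1 d * d ^ 2 * ((n : ℝ) / ((R : ℝ) - 1)) := by
  have h := (pred_pos hR).ne'
  unfold ell1C lip1 c1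
  field_simp
  ring

/-- `n²·ell2 = c₂·Y²`. [folklore] -/
theorem sq_mul_ell2 (d n : ℕ) : (n : ℝ) ^ 2 * ell2 d R = c2 d * ((n : ℝ) / ((R : ℝ) - 1)) ^ 2 := by
  have h := (pred_pos hR).ne'
  unfold ell2 ell1 lip1 lip2 c2 c1
  field_simp
  ring

/-- `n²·ell2C = c₂′·Y²`. [folklore] -/
theorem sq_mul_ell2C (d n : ℕ) : (n : ℝ) ^ 2 * ell2C d R = c2C d * ((n : ℝ) / ((R : ℝ) - 1)) ^ 2 := by
  have h := (pred_pos hR).ne'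
  unfold ell2C ell1C lip1 lip2 c2C c1
  field_simp
  ring

variable (hRn : R - 1 ≤ n)
include hRn

/-- `Y = n/(R−1) ≥ 1`. [folklore] -/
theorem one_le_Y : 1 ≤ (n : ℝ) / ((R : ℝ) - 1) := by
  rw [le_div_iff₀ (pred_pos hR), one_mul]
  have h1 : ((R - 1 : ℕ) : ℝ) ≤ n := by exact_mod_cast hRn
  have h2 : ((R - 1 : ℕ) : ℝ) = (R : ℝ) - 1 := by
    rw [Nat.cast_sub (by omega)]; simp
  linarith

/-- `A_E ≤ a_E·Y`. [folklore] -/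
theorem AE_le : AE d a' n R ≤ aE d a' * ((n : ℝ) / ((R : ℝ) - 1)) := by
  set Y := (n : ℝ) / ((R : ℝ) - 1) with hY
  have hY1 := one_le_Y hR hRn
  have hY0 : 0 ≤ Y := by linarith
  have hγ := (gammaPs_pos (d := d) (a' := a')).1
  have hK : 0 ≤ 2 * (gammaPs d a')⁻¹ + 2 * d ^ 5 * c1 d ^ 2 * (gammaPs d a')⁻¹ ^ 2 := by positivity
  have hrhs : aE d a' * Y = Real.sqrt ((2 * (gammaPs d a')⁻¹ + 2 * d ^ 5 * c1 d ^ 2 * (gammaPs d a')⁻¹ ^ 2) * Y ^ 2) := by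
    unfold aE; rw [Real.sqrt_mul hK, Real.sqrt_sq hY0]
  rw [hrhs]
  unfold AE
  rw [mul_ell1C hR, ← hY]
  refine Real.sqrt_le_sqrt ?_
  have hc := c1_nonneg d
  have : 2 * (gammaPs d a')⁻¹ ≤ 2 * (gammaPs d a')⁻¹ * Y ^ 2 := by
    have : (1 : ℝ) ≤ Y ^ 2 := by nlinarith
    nlinarith [inv_nonneg.mpr hγ.le]
  nlinarith [sq_nonneg (c1 d * d ^ 2 * Y), inv_nonneg.mpr hγ.le]

/-- `A₁ ≤ a₁·Y`. [folklore] -/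
theorem A1_le : A1 d a' n R ≤ a1 d a' * ((n : ℝ) / ((R : ℝ) - 1)) := by
  set Y := (n : ℝ) / ((R : ℝ) - 1) with hY
  have hY1 := one_le_Y hR hRn
  have hY0 : 0 ≤ Y := by linarith
  have hγ := (gammaPs_pos (d := d) (a' := a')).1
  have hAE := AE_le hR hRn (d := d) (a' := a')
  have hAE0 : 0 ≤ AE d a' n R := Real.sqrt_nonneg _
  have hAE2 : AE d a' n R ^ 2 ≤ (aE d a' * Y) ^ 2 := pow_le_pow_left₀ hAE0 hAE 2
  have hK : 0 ≤ 2 * aE d a' ^ 2 + 2 * d * c1 d ^ 2 * (gammaPs d a')⁻¹ ^ 2 := by positivity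
  have hrhs : a1 d a' * Y = Real.sqrt ((2 * aE d a' ^ 2 + 2 * d * c1 d ^ 2 * (gammaPs d a')⁻¹ ^ 2) * Y ^ 2) := by
    unfold a1; rw [Real.sqrt_mul hK, Real.sqrt_sq hY0]
  rw [hrhs]
  unfold A1
  rw [mul_ell1 hR, ← hY]
  refine Real.sqrt_le_sqrt ?_
  nlinarith [hAE2, sq_nonneg (c1 d * Y), inv_nonneg.mpr hγ.le]

/-- `A_Δ ≤ a_Δ·Y²`. [folklore] -/
theorem AD_le : AD d a' n R ≤ aD d a' * ((n : ℝ) / ((R : ℝ) - 1)) ^ 2 := by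
  set Y := (n : ℝ) / ((R : ℝ) - 1) with hY
  have hY1 := one_le_Y hR hRn
  have hY0 : 0 ≤ Y := by linarith
  have hYY : Y ≤ Y ^ 2 := by nlinarith
  have hY2 : 1 ≤ Y ^ 2 := by nlinarith
  have hγ := (gammaPs_pos (d := d) (a' := a')).1
  have hc := c1_nonneg d
  unfold AD aD
  rw [mul_ell1C hR, sq_mul_ell2C hR, ← hY]
  have h1 : Real.sqrt (2 * (1 + (a' * (gammaPs d a')⁻¹) ^ 2)) ≤ Real.sqrt (2 * (1 + (a' * (gammaPs d a')⁻¹) ^ 2)) * Y ^ 2 :=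
    le_mul_of_one_le_right (Real.sqrt_nonneg _) hY2
  have h2 : 2 * (c1 d * d ^ 2 * Y) * Real.sqrt ((gammaPs d a')⁻¹) ≤ 2 * (c1 d * d ^ 2) * Real.sqrt ((gammaPs d a')⁻¹) * Y ^ 2 := by
    have : 0 ≤ 2 * (c1 d * d ^ 2) * Real.sqrt ((gammaPs d a')⁻¹) := by positivity
    nlinarith
  have h3 : 0 ≤ c2C d * Y ^ 2 * (gammaPs d a')⁻¹ := by unfold c2C; positivity
  have hd : (0 : ℝ) ≤ d := Nat.cast_nonneg d
  nlinarith [mul_le_mul_of_nonneg_left (add_le_add h2 (le_refl (c2C d * Y ^ 2 * (gammaPs d a')⁻¹))) hd]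

/-- `A₂ ≤ a₂·Y²`. [folklore] -/
theorem A2_le : A2 d a' n R ≤ a2 d a' * ((n : ℝ) / ((R : ℝ) - 1)) ^ 2 := by
  set Y := (n : ℝ) / ((R : ℝ) - 1) with hY
  have hY1 := one_le_Y hR hRn
  have hY0 : 0 ≤ Y := by linarith
  have hγ := (gammaPs_pos (d := d) (a' := a')).1
  have hc := c1_nonneg d
  have hAD := AD_le hR hRn (d := d) (a' := a')
  have hAE := AE_le hR hRn (d := d) (a' := a')
  have haE := aE_nonneg d a'
  unfold A2 a2
  rw [mul_ell1 hR, sq_mul_ell2 hR, ← hY]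
  rw [← hY] at hAD hAE
  have h2 : 2 * (c1 d * Y) * AE d a' n R ≤ 2 * c1 d * aE d a' * Y ^ 2 := by
    have := mul_le_mul_of_nonneg_left hAE (by positivity : 0 ≤ 2 * (c1 d * Y))
    nlinarith
  have h3 : 0 ≤ c2 d * Y ^ 2 * (gammaPs d a')⁻¹ := by unfold c2; positivity
  have hd : (0 : ℝ) ≤ d := Nat.cast_nonneg d
  nlinarith [mul_le_mul_of_nonneg_left (add_le_add h2 (le_refl (c2 d * Y ^ 2 * (gammaPs d a')⁻¹))) hd]

omit hRn in
/-- `A₂ ≥ 0` (`R ≥ 2`). [folklore] -/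
theorem A2_nonneg : 0 ≤ A2 d a' n R := by
  have hγ := (gammaPs_pos (d := d) (a' := a')).1
  have hl1 : 0 ≤ ell1 d R := by have := lip1_nonneg hR; unfold ell1; positivity
  have hl1C : 0 ≤ ell1C d R := by have := lip1_nonneg hR; unfold ell1C; positivity
  have hl2 : 0 ≤ ell2 d R := by have := lip2_nonneg (R := R); unfold ell2; positivity
  have hl2C : 0 ≤ ell2C d R := by have := lip2_nonneg (R := R); unfold ell2C; positivity
  have hAE : 0 ≤ AE d a' n R := Real.sqrt_nonneg _
  unfold A2 AD; positivity

/-- **`A₁A₂ ≤ Kfar·Y³`.** [folklore] -/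
theorem A1_mul_A2_le : A1 d a' n R * A2 d a' n R ≤ Kfar d a' * ((n : ℝ) / ((R : ℝ) - 1)) ^ 3 := by
  have hY1 := one_le_Y hR hRn
  have h1 := A1_le hR hRn (d := d) (a' := a')
  have h2 := A2_le hR hRn (d := d) (a' := a')
  have hA2 := A2_nonneg hR (d := d) (a' := a') (n := n)
  have ha1 := a1_nonneg d a'
  calc A1 d a' n R * A2 d a' n R ≤ (a1 d a' * ((n : ℝ) / ((R : ℝ) - 1))) * (a2 d a' * ((n : ℝ) / ((R : ℝ) - 1)) ^ 2) :=
        mul_le_mul h1 h2 hA2 (mul_nonneg ha1 (by linarith))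
    _ = Kfar d a' * ((n : ℝ) / ((R : ℝ) - 1)) ^ 3 := by unfold Kfar; ring

end Scaling

/-- the near-part window constant for `m = 2R + 3` (`n₀ + 1 = 4m = 8R + 12`): `ell1C²·(n₀(n₀+1)) ≤ (28c₁d²)²` (`R ≥ 2`). [folklore] -/
theorem ell1C_sq_window_le (hR : 2 ≤ R) (d : ℕ) :
    ell1C d R ^ 2 * (((8 * R + 11 : ℕ) : ℝ) * ((8 * R + 11 : ℕ) + 1)) ≤ (28 * c1 d * d ^ 2) ^ 2 := by
  have hpos := pred_pos hR
  have hR' : (2 : ℝ) ≤ R := by exact_mod_cast hR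
  have hc := c1_nonneg d
  have hE : ell1C d R = c1 d * d ^ 2 / ((R : ℝ) - 1) := by
    unfold ell1C lip1 c1; field_simp; ring
  rw [hE, div_pow]
  rw [div_mul_eq_mul_div, div_le_iff₀ (by positivity)]
  push_cast
  have hw : ((8 : ℝ) * R + 11) * (8 * R + 11 + 1) ≤ (28 * ((R : ℝ) - 1)) ^ 2 := by nlinarith
  calc (c1 d * d ^ 2) ^ 2 * ((8 * (R : ℝ) + 11) * (8 * R + 11 + 1))
      ≤ (c1 d * d ^ 2) ^ 2 * (28 * ((R : ℝ) - 1)) ^ 2 := mul_le_mul_of_nonneg_left hw (by positivity)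
    _ = (28 * c1 d * d ^ 2) ^ 2 * ((R : ℝ) - 1) ^ 2 := by ring

end Summit.QuantumFields.BalabanUV.T4Continuum.DirichletCutoutBudgetConstants

end
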